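import Literature.Probability.LatticeModels.AnisotropicPlaneRotatorInfraredBound
import Literature.MathematicalPhysics.QuantumFieldTheory.Balaban1983to89.Beta.PuncturedRiemannSum
import HarnessLib

/-!
# Long-range order of the layered plane rotator from the anisotropic infrared bound: the thermodynamic-limit floor with Fröhlich–Israel–Lieb–Simon's constant `C₀ = (2π)⁻³∫ d³p / E_p`

Topic `Probability/LatticeModels`; the infinite-volume form of `AnisotropicPlaneRotatorInfraredBound.lean`.
There, for every even `L ≥ 4` and couplings `J_i > 0`, the plateau of the plane rotator on `(ℤ/Lℤ)³`
with direction-dependent nearest-neighbour couplings obeys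
`L⁻⁶∑_{x,y}⟨cos(θ_x − θ_y)⟩_J ≥ 1 − L⁻³∑_{k≠0} ε_J(2πk/L)⁻¹`, `ε_J(p) = ∑ᵢ J_i(1 − cos pᵢ)`
(`AnisotropicRotator.plateau_ge_infraredBound`). Here the Riemann sum is sent to its limit, exactly
as in Fröhlich–Israel–Lieb–Simon 1978, (4.6)–(4.10) ("for `E_p` a function satisfying
`(2π)^{-ν}∫ E_p⁻¹ d^νp ≡ C₀ < ∞` (4.7) … `lim_{|Λ|→∞} |Λ|⁻¹ g_Λ(p = 0) > 0` (4.9), since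
`|Λ|⁻¹g_Λ(0) ≥ ⟨σ_α²⟩ − |Λ|⁻¹∑_{p≠0} 1/2βE_p` (4.10)", "assuming some regularity on `E_p`"), using the
tree's generic punctured Riemann-sum theorem for `2π`-periodic symbols with an integrable `1/ε`
singularity (`PuncturedRiemannSum.momentumAverage_singular_approx`, `d ≥ 3`; the symbol `1/ε_J` is in
its class with `C₁ = 1/minᵢJᵢ`):

* `AnisotropicRotator.infraredConstant K = (2π)^{-d}∫_{[-π,π]^d} dp/ε_K(p)` — FILS's `C₀` of (4.7) for
  the direction-dependent nearest-neighbour coupling (for `K ≡ 1`, `d = 3` it is the tree's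
  `latticeGreen 0`, Friedli–Velenik's `β₀`-integral);
* `AnisotropicRotator.torusSum_inv_anisoDispersion_approx` — `|L^{-d}∑_{k≠0} ε_K(2πk/L)⁻¹ − C₀(K)| ≤ ε`
  for all large even `L` (`d ≥ 3`, `K_i ≥ m > 0`);
* `AnisotropicRotator.longRangeOrder_infraredBound` — for `J_i > 0` and `ε > 0`, for all large even `L`,
  `L⁻⁶∑_{x,y}⟨cos(θ_x − θ_y)⟩_J ≥ 1 − C₀(J) − ε`: LONG-RANGE ORDER WHENEVER `C₀(J) < 1` (FILS (4.9) with
  `⟨σ²⟩ = 1`, `2β ↦` our normalisation);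
* `AnisotropicRotator.klsConstant r = (2π)⁻³∫ d³q/E^r_q` with Kennedy–Lieb–Shastry's
  `E^r_q = 2 − cos q₁ − cos q₂ + r(1 − cos q₃)`, `infraredConstant_layeredCoupling`:
  `C₀(J∥,J∥,J⊥) = klsConstant(J⊥/J∥)/J∥`, and `AnisotropicRotator.layered_longRangeOrder_infraredBound`:
  for `J∥, J⊥ > 0`, LRO of the layered classical XY model (plateau `≥ 1 − klsConstant(J⊥/J∥)/J∥ − ε` for
  all large even `L`) — an ordering FLOOR `J∥ > C(J⊥/J∥)`, `C(r) = (2π)⁻³∫d³q/E^r_q`; in temperature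
  units (`J = J_phys/T`, `r = J⊥/J∥` temperature-independent) `T_c ≥ J∥,phys / C(J⊥/J∥)`.

`C(r)` is finite for every `r > 0` and grows only logarithmically as `r ↓ 0` (the `q₃`-integral of
`1/E^r_q` is `2π/√(ε₂(ε₂+2r))`, `ε₂ = 2 − cos q₁ − cos q₂`); that asymptotic statement and any numerical
value of `C(r)` are NOT proved here ([float], for the record: `C(1) = latticeGreen 0 ≈ 0.5055`). What IS
proved is the floor with the explicit integral `C(r)`, which contains the interlayer logarithm. Proved;
no named fact; classical comparison model only.

## References

* J. Fröhlich, R. Israel, E. H. Lieb, B. Simon, *Phase transitions and reflection positivity. I*,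
  Comm. Math. Phys. 62 (1978) 1–34, Thm. 4.7, (4.6)–(4.10) [FILS1978].
* T. Kennedy, E. H. Lieb, B. S. Shastry, J. Stat. Phys. 53 (1988) 1019–1030, eq. (7) [KLS1988JSP].
* S. Friedli, Y. Velenik, *Statistical Mechanics of Lattice Systems*, CUP (2017), Thm. 10.25,
  (10.40)–(10.42) (the Riemann-sum passage) [FriedliVelenikSMLS2017].
-/

noncomputable section

open MeasureTheory Set Finset Filter
open scoped BigOperators Real

namespace Literature.Probability.LatticeModels

namespace AnisotropicRotator

open NVectorAniso PlaneRotator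
open Literature.MathematicalPhysics.QuantumFieldTheory.Balaban1983to89.Beta.PuncturedRiemannSum

/-! ### FILS's constant `C₀ = (2π)^{-d}∫ dp/E_p` for the anisotropic dispersion -/

/-- **Fröhlich–Israel–Lieb–Simon's constant** `C₀(K) = (2π)^{-d} ∫_{[-π,π]^d} dp / ε_K(p)`,
`ε_K(p) = ∑ᵢ K_i(1 − cos pᵢ)` — their (4.7) for the nearest-neighbour coupling with one constant per
direction. [cite: FILS1978, eq. (4.7)] -/
def infraredConstant {d : ℕ} (K : Fin d → ℝ) : ℝ :=
  ((2 * π) ^ d)⁻¹ * ∫ p in brillouin d, 1 / anisoDispersion K p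

variable {d : ℕ}

/-- `ε_K ≥ m·ε` when `K_i ≥ m`. [folklore] -/
private theorem mul_dispersion_le {K : Fin d → ℝ} {m : ℝ} (hmK : ∀ i, m ≤ K i) (p : Fin d → ℝ) :
    m * dispersion p ≤ anisoDispersion K p := by
  unfold dispersion anisoDispersion
  rw [Finset.mul_sum]
  exact Finset.sum_le_sum fun i _ =>
    mul_le_mul_of_nonneg_right (hmK i) (sub_nonneg.2 (Real.cos_le_one _))

/-- `ε_K > 0` on the punctured Brillouin zone (`K_i ≥ m > 0`). [folklore] -/
private theorem anisoDispersion_pos_of_mem_brillouin {K : Fin d → ℝ} {m : ℝ} (hm : 0 < m)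
    (hmK : ∀ i, m ≤ K i) {p : Fin d → ℝ} (hp : p ∈ brillouin d) (hp0 : p ≠ 0) :
    0 < anisoDispersion K p :=
  lt_of_lt_of_le (mul_pos hm (dispersion_pos_of_mem_brillouin hp hp0)) (mul_dispersion_le hmK p)

/-- `ε_K` is continuous. [folklore] -/
private theorem continuous_anisoDispersion (K : Fin d → ℝ) :
    Continuous fun p : Fin d → ℝ => anisoDispersion K p := by
  unfold anisoDispersion
  fun_prop

/-- `1/ε_K` is continuous on the punctured zone. [folklore] -/
private theorem continuousOn_inv_anisoDispersion {K : Fin d → ℝ} {m : ℝ} (hm : 0 < m)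
    (hmK : ∀ i, m ≤ K i) :
    ContinuousOn (fun p : Fin d → ℝ => 1 / anisoDispersion K p) (brillouin d \ {0}) :=
  continuousOn_const.div (continuous_anisoDispersion K).continuousOn fun _ hp =>
    (anisoDispersion_pos_of_mem_brillouin hm hmK hp.1 hp.2).ne'

/-- `1/ε_K` is in the singular class of the punctured Riemann-sum theorem: `|1/ε_K(p)| ≤ 0 + (1/m)/ε(p)`
off the origin. [folklore] -/
private theorem norm_inv_anisoDispersion_le {K : Fin d → ℝ} {m : ℝ} (hm : 0 < m) (hmK : ∀ i, m ≤ K i)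
    {p : Fin d → ℝ} (hp : p ∈ brillouin d) (hp0 : p ≠ 0) :
    ‖1 / anisoDispersion K p‖ ≤ 0 + (1 / m) / dispersion p := by
  have hε := dispersion_pos_of_mem_brillouin hp hp0
  have hεK := anisoDispersion_pos_of_mem_brillouin hm hmK hp hp0
  rw [Real.norm_eq_abs, abs_of_pos (one_div_pos.2 hεK), zero_add, div_div]
  exact one_div_le_one_div_of_le (mul_pos hm hε) (mul_dispersion_le hmK p)

/-- `ε_K` is `2π`-periodic in each coordinate. [folklore] -/
private theorem anisoDispersion_add_int_mul (K : Fin d → ℝ) (p : Fin d → ℝ) (n : Fin d → ℤ) :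
    anisoDispersion K (fun i => p i + 2 * π * (n i : ℝ)) = anisoDispersion K p := by
  unfold anisoDispersion
  refine Finset.sum_congr rfl fun i _ => ?_
  dsimp only
  rw [mul_comm (2 * π) (n i : ℝ), Real.cos_add_int_mul_two_pi]

/-- **The torus sum of `1/ε_K` converges to `C₀(K)`** (the Riemann-sum passage of FILS (4.9)–(4.10),
"assuming some regularity on `E_p`"; here from the tree's generic punctured Riemann-sum theorem for
`2π`-periodic symbols bounded by `C₁/ε`, `d ≥ 3`): for `K_i ≥ m > 0` and `ε > 0`, for all large even
`L`, `|L^{-d}∑_{k≠0} ε_K(2πk/L)⁻¹ − C₀(K)| ≤ ε`.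
[cite: FILS1978, (4.7)–(4.10)] [cite: FriedliVelenikSMLS2017, (10.41)] -/
theorem torusSum_inv_anisoDispersion_approx (hd : 3 ≤ d) {K : Fin d → ℝ} {m : ℝ} (hm : 0 < m)
    (hmK : ∀ i, m ≤ K i) {ε : ℝ} (hε : 0 < ε) :
    ∃ L₀ : ℕ, ∀ (L : ℕ) [NeZero L], Even L → L₀ ≤ L →
      |1 / (L : ℝ) ^ d * ∑ k ∈ Finset.univ.erase (0 : TorusSite d L),
          1 / anisoDispersion K (latticeMomentum L k) - infraredConstant K| ≤ ε := by
  obtain ⟨L₀, hL₀⟩ := momentumAverage_singular_approx hd (E := ℝ) le_rfl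
    (one_div_pos.2 hm).le (continuousOn_inv_anisoDispersion hm hmK)
    (fun p hp hp0 => norm_inv_anisoDispersion_le hm hmK hp hp0)
    (fun p n => by simp only [anisoDispersion_add_int_mul]) hε
  refine ⟨L₀, fun L _ hev hL => ?_⟩
  have h := hL₀ L hev hL
  rw [smul_eq_mul, smul_eq_mul, Real.norm_eq_abs] at h
  have hL0 : ((L ^ d : ℕ) : ℝ) = (L : ℝ) ^ d := by push_cast; ring
  rw [hL0] at h
  rwa [infraredConstant, one_div]

/-! ### Long-range order whenever `C₀(J) < 1` -/

/-- **Long-range order of the plane rotator with direction-dependent couplings from the anisotropic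
infrared bound** (FILS 1978, (4.9)–(4.10) with Thm. 4.7, for the reflection-positive nearest-neighbour
coupling with one constant per direction; `⟨σ²⟩ = 1` for unit spins): for `J_i > 0` and `ε > 0`, for
all large even `L`, `L⁻⁶∑_{x,y}⟨cos(θ_x − θ_y)⟩_J ≥ 1 − C₀(J) − ε`, `C₀(J) = (2π)⁻³∫ d³p/ε_J(p)`.
[cite: FILS1978, Thm. 4.7 with (4.7)–(4.10)] -/
theorem longRangeOrder_infraredBound {J : Fin 3 → ℝ} (hJ : ∀ i, 0 < J i) {ε : ℝ} (hε : 0 < ε) :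
    ∃ L₀ : ℕ, ∀ (L : ℕ) [NeZero L], L₀ ≤ L → Even L → 4 ≤ L →
      1 - infraredConstant J - ε ≤ plateau L J := by
  set m : ℝ := min (J 0) (min (J 1) (J 2)) with hm
  have hm0 : 0 < m := lt_min (hJ 0) (lt_min (hJ 1) (hJ 2))
  have hmK : ∀ i, m ≤ J i := fun i => by
    fin_cases i
    · exact min_le_left _ _
    · exact (min_le_right _ _).trans (min_le_left _ _)
    · exact (min_le_right _ _).trans (min_le_right _ _)
  obtain ⟨L₀, hL₀⟩ := torusSum_inv_anisoDispersion_approx (d := 3) le_rfl hm0 hmK hε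
  refine ⟨L₀, fun L _ hL hLe hL4 => ?_⟩
  have h1 := plateau_ge_infraredBound L hLe hL4 hJ
  have h2 := hL₀ L hLe hL
  linarith [(abs_le.1 h2).2]

/-! ### The layered model: `C₀(J∥,J∥,J⊥) = C(J⊥/J∥)/J∥` with Kennedy–Lieb–Shastry's `E^r_q` -/

/-- The constant `C(r) = (2π)⁻³ ∫_{[-π,π]³} d³q / E^r_q`, `E^r_q = 2 − cos q₁ − cos q₂ + r(1 − cos q₃)`
(FILS's `C₀` of (4.7) for Kennedy–Lieb–Shastry's dispersion (7)). [cite: FILS1978, eq. (4.7)] [cite: KLS1988JSP, eq. (7)] -/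
def klsConstant (r : ℝ) : ℝ :=
  ((2 * π) ^ 3)⁻¹ * ∫ q in brillouin 3, 1 / klsDispersion r q

/-- `C₀(J∥,J∥,J⊥) = C(J⊥/J∥)/J∥` (`J∥ ≠ 0`). [cite: KLS1988JSP, eq. (7)] -/
theorem infraredConstant_layeredCoupling {Jpar Jperp : ℝ} (hpar : Jpar ≠ 0) :
    infraredConstant (layeredCoupling Jpar Jperp) = klsConstant (Jperp / Jpar) / Jpar := by
  unfold infraredConstant klsConstant
  simp_rw [anisoDispersion_layeredCoupling hpar, ← one_div_mul_one_div]
  rw [integral_const_mul]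
  ring

/-- **The interlayer ordering floor in the thermodynamic limit**: for `J∥, J⊥ > 0` and `ε > 0`, for all
large even `L`, the layered classical XY model on `(ℤ/Lℤ)³` has
`L⁻⁶∑_{x,y}⟨cos(θ_x − θ_y)⟩_{(J∥,J∥,J⊥)} ≥ 1 − C(J⊥/J∥)/J∥ − ε`, `C(r) = (2π)⁻³∫d³q/E^r_q` — long-range
order as soon as `J∥ > C(J⊥/J∥)` (FILS's criterion (4.9)–(4.10) `β > β₁ = C₀/2D` in the present
normalisation, for the reflection-positive layered coupling). [cite: FILS1978, Thm. 4.7 with (4.7)–(4.10)] [cite: KLS1988JSP, eqs. (5)–(7)] -/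
theorem layered_longRangeOrder_infraredBound {Jpar Jperp : ℝ} (hpar : 0 < Jpar) (hperp : 0 < Jperp)
    {ε : ℝ} (hε : 0 < ε) :
    ∃ L₀ : ℕ, ∀ (L : ℕ) [NeZero L], L₀ ≤ L → Even L → 4 ≤ L →
      1 - klsConstant (Jperp / Jpar) / Jpar - ε ≤ plateau L (layeredCoupling Jpar Jperp) := by
  have hJ : ∀ i, 0 < layeredCoupling Jpar Jperp i := fun i => by
    unfold layeredCoupling
    split_ifs
    · exact hperp
    · exact hpar
  rw [← infraredConstant_layeredCoupling hpar.ne']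
  exact longRangeOrder_infraredBound hJ hε

end AnisotropicRotator

end Literature.Probability.LatticeModels
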